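import Summits.QuantumFields.BalabanUV.Beta.FP.TowerK2bDoorGapTadpole

/-!
# `BalabanUV.Beta.FP.TowerK2bDoorTadpoleZerothMoment` — binder row D1 ∕ (C1) OWNER «beta-an2», PART 40: **THE ZEROTH MOMENT OF A COVARIANT SYMMETRISED DOOR
# PAIRING IS THE PAIRING OF COLUMN SUMS; IT VANISHES AS SOON AS THE TRANSLATION-SUMMED GAUGE COLUMN HAS NO DOOR WORD — IN PARTICULAR WHEN IT IS CONSTANT**
# (road «FP» g51's Q-FP-51-1 «is an4's `hD0` for the tadpole defect a theorem?», answered in kernel letters over PART 38∕39; SPEC-64 §10 (ii-A″) row `hD0`)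

WHY.  The door family's tadpole at a source pair `(a, a′) = ((μ,0),(ν,z))` is, in the fold Engine C's K2L-DTAD emits (its `tau_manifest`, j312151) and in (T2)'s right
side, a COVARIANT SYMMETRISED BILINEAR PAIRING over the coarse windows `β = (κ, y)`:
`X(a,a′) = Σ_β (Ŝ_{a′}(β)·τ_β(λ_a) + Ŝ_a(β)·τ_β(λ_{a′}))`, where `Ŝ_a` is the read-out weight of source `a`, `λ_a` its gauge column, and `τ_β` the door word of
window `β` (PART 37∕38: a commutator of the window's tables with the generator `diagonal (λ ∘ pr)` ∕ `diagonal (λ ∘ rt)`, traced against the propagator — PART 39),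
ℝ-LINEAR in `λ`; all three are covariant under the coarse translations: `Ŝ_{(ν,z)}(κ,y) = Ŝ_{(ν,0)}(κ,y−z)`, `τ_{(κ,y)}(λ_{(μ,z)}) = τ_{(κ,y−z)}(λ_{(μ,0)})`.
an4's remainder binder `hD0` (SPEC-64 §10 (ii-A″), road `StepRecursionFeedNestedCompDoor` p653301) asks the ZEROTH MOMENT `Σ_z X((μ,0),(ν,z))` to vanish; by value
it does at n = 0, p = 4 (16∕16 source pairs, `≤ 2e−16` relative — K2L-DTAD fold, road g51 and row g74 coincide; zero weight).  THIS FILE types WHY in kernel letters: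
§1 **`zerothMoment_symPairing_eq`** — over any finite additive torus `G` of positions: `Σ_z X((μ,0),(ν,z)) = Σ_κ (SŜ_ν(κ)·τ_{(κ,0)}(Λ_μ) + SŜ_μ(κ)·τ_{(κ,0)}(Λ_ν))` with the
   column sums `SŜ_ν(κ) := Σ_y Ŝ_{(ν,0)}(κ,y)` and THE TRANSLATION-SUMMED GAUGE COLUMN `Λ_μ := Σ_z λ_{(μ,z)}` (reindexing by the translation bijections + linearity:
   `Σ_y τ_{(κ,y)}(λ_{(μ,0)}) = τ_{(κ,0)}(Λ_μ)` — `colSum_eq_apply_translationSum`);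
§2 **`zerothMoment_symPairing_eq_zero`** — hence `Σ_z X = 0` under the ONE displayed letter `hΛ : ∀ κ μ, τ_{(κ,0)}(Λ_μ) = 0` («the summed gauge column has no door
   word»), and **`zerothMoment_symPairing_eq_zero_of_translationSum_eq_smul`** — in particular when every `Λ_μ` is a multiple of one vector `u` killed by every word
   (the CONSTANT gauge function);
§3 the constant generator has no door: **`mul_diagonal_const_comm`** (`L̂·diagonal(c) = diagonal(c)·L̂` for rectangular legs), **`fineDoor_const_eq_zero`**
   (`[diagonal c, B] = 0`), **`doorGap_const_eq_zero`** (PART 38 §4 `doorGap_eq_zero_of_intertwine` at the scalar generator), and traced: **`trace_mul_fineDoor_const`**,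
   **`trace_mul_brickDoor_const`**, **`trace_mul_doorGap_const`** `= 0` — so for the matrix words of PART 37∕38∕39 the letter `hΛ` IS «`Σ_z λ_{(μ,z)}` is constant on
   sites and roots».
READING (zero weight; nothing asserted about the record): by value (row g75 `gen75/cert/q51/fold_m0_mechanism.py` on the deposited `TAU_p4.npz`) `τ_{(κ,0)}(Λ_μ) = 0`
at 16∕16 `(κ,μ)` for every emitted word, so `hD0` at n = 0 follows from §1–§2 ALONE; whether `Λ_μ` is constant (§3's case — the row's conjectured mechanism: with
centred roots the nested comb ramp equals the one-shot ramp, so both charts send uniform data to the same axial representative) is ONE by-value number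
(R-AN2-75-LAM, `requests.jsonl` l.4527) and, at the record's letters, the ONE file's to prove.  [folklore] finite sums + `Matrix` algebra BY NAME over abstract
finite index types and an abstract finite additive group; no `def`, no `def … : Prop`, nothing cited, 0 sorry; imports PART 39 only.  Nothing of Bałaban's
asserted, valued or discharged; `hD0` NOT discharged at the record's letters (the letter `hΛ` is DISPLAYED); `hDΔ ∕ hD1 ∕ hD2 ∕ hDF ∕ hDΔtr ∕ D1Tel` NOT claimed
either way; (J-R₂″) NOT claimed; 0∕4 row-D1 binders (hW ∕ hR ∕ D1Tel ∕ D1Rep); NOT (C1), NOT (T-ID), NOT D1, NEVER «G-an2-4 closed», NOT BetaPertH, NOT continuum,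
NOT Clay.
HONEST DEPENDENCY (page 1, mandatory): continuum YM on T⁴ ⇐ BetaPertH ∧ nine spine estimates (0/9 proved); BetaPertH ⇐ (D1) ∧ (D4) ∧ CAP+tail;
G-an2-4 gates asym, D1 and NE2/3/4.  HONEST FRAMING (cell contract, verbatim): «discharging `BetaPertH` makes Bałaban's UV stability UNCONDITIONAL —
a real constructive-QFT result; it is NOT the continuum limit and NOT the Clay problem.»  ABSOLUTE RULE (cell charter, verbatim): «No internally-minted
statement may enter as a cited fact. Every hypothesis is either kernel-proved in this package or a verbatim quotation of a PUBLISHED theorem with page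
reference. The manuscript(s) under audit are NOT citable for their own disputed steps — they are the thing under adjudication; programme-internal
(2001/route/tribunal) claims are never citable.»  Row D1 ∕ (C1) OWNER, b2b-balaban-beta-an2 gen 75, 2026-08-28.  No existing file touched.
-/

noncomputable section

open scoped BigOperators

namespace Summit.QuantumFields.BalabanUV.Beta.FP.TowerK2bDoorTadpoleZerothMoment

open Finset Matrix
open Summit.QuantumFields.BalabanUV.Beta.FP.TowerK2bDoorGapTelescope (doorGap_eq_zero_of_intertwine)

/-! ## §1 The zeroth moment of a covariant symmetrised pairing is the pairing of column sums -/

section Pairing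

variable {D G V : Type*} [Fintype D] [AddCommGroup G] [Fintype G] [AddCommGroup V] [Module ℝ V]

/-- [folklore] reindexing by a translation: `Σ_z f(y − z) = Σ_w f(w)` on a finite additive group. -/
theorem sum_sub_left_eq (f : G → ℝ) (y : G) : ∑ z, f (y - z) = ∑ w, f w :=
  Fintype.sum_equiv (Equiv.subLeft y) (fun z => f (y - z)) f (fun _ => rfl)

/-- [folklore] reindexing by negation: `Σ_z f(−z) = Σ_w f(w)`. -/
theorem sum_neg_eq (f : G → ℝ) : ∑ z, f (-z) = ∑ w, f w :=
  Fintype.sum_equiv (Equiv.neg G) (fun z => f (-z)) f (fun _ => rfl)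

omit [Fintype D] in
/-- [folklore] **`colSum_eq_apply_translationSum`**: for door words `τ_{(κ,y)} : V →ₗ[ℝ] ℝ` and gauge columns `λ_{(μ,z)} : V` that are JOINTLY COVARIANT under the
translations (`τ_{(κ,y)}(λ_{(μ,z)}) = τ_{(κ,y−z)}(λ_{(μ,0)})`), the column sum of the words of ONE column is the base word of the TRANSLATION-SUMMED column:
`Σ_y τ_{(κ,y)}(λ_{(μ,0)}) = τ_{(κ,0)}(Σ_z λ_{(μ,z)})`. -/
theorem colSum_eq_apply_translationSum (tau : D → G → V →ₗ[ℝ] ℝ) (lam : D → G → V)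
    (hτ : ∀ (κ : D) (y : G) (μ : D) (z : G), tau κ y (lam μ z) = tau κ (y - z) (lam μ 0)) (κ μ : D) :
    ∑ y, tau κ y (lam μ 0) = tau κ 0 (∑ z, lam μ z) := by
  rw [map_sum]
  have h : ∀ z, tau κ 0 (lam μ z) = tau κ (-z) (lam μ 0) := fun z => by rw [hτ, zero_sub]
  simp only [h]
  exact (sum_neg_eq (fun w => tau κ w (lam μ 0))).symm

/-- [folklore] **`zerothMoment_symPairing_eq` — THE ZEROTH MOMENT OF THE COVARIANT SYMMETRISED PAIRING**: with read-out weights `Ŝ_{(ν,z)}(κ,y) = S ν z κ y`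
covariant (`S ν z κ y = S ν 0 κ (y − z)`), door words `τ` and gauge columns `λ` jointly covariant as above, and the pairing
`X((μ,0),(ν,z)) := Σ_κ Σ_y (S ν z κ y · τ_{(κ,y)}(λ_{(μ,0)}) + S μ 0 κ y · τ_{(κ,y)}(λ_{(ν,z)}))`:
`Σ_z X((μ,0),(ν,z)) = Σ_κ ((Σ_y S ν 0 κ y) · τ_{(κ,0)}(Σ_z λ_{(μ,z)}) + (Σ_y S μ 0 κ y) · τ_{(κ,0)}(Σ_z λ_{(ν,z)}))`. -/
theorem zerothMoment_symPairing_eq (S : D → G → D → G → ℝ) (tau : D → G → V →ₗ[ℝ] ℝ) (lam : D → G → V)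
    (hS : ∀ (ν : D) (z : G) (κ : D) (y : G), S ν z κ y = S ν 0 κ (y - z))
    (hτ : ∀ (κ : D) (y : G) (μ : D) (z : G), tau κ y (lam μ z) = tau κ (y - z) (lam μ 0)) (μ ν : D) :
    ∑ z, ∑ κ, ∑ y, (S ν z κ y * tau κ y (lam μ 0) + S μ 0 κ y * tau κ y (lam ν z))
      = ∑ κ, ((∑ y, S ν 0 κ y) * tau κ 0 (∑ z, lam μ z) + (∑ y, S μ 0 κ y) * tau κ 0 (∑ z, lam ν z)) := by
  rw [Finset.sum_comm]
  refine Finset.sum_congr rfl fun κ _ => ?_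
  rw [← colSum_eq_apply_translationSum tau lam hτ κ μ, ← colSum_eq_apply_translationSum tau lam hτ κ ν]
  simp only [Finset.sum_add_distrib]
  congr 1
  · -- the `Ŝ_{a′}`-translated half: `Σ_z Σ_y S ν z κ y · τ_{(κ,y)}(λ_{(μ,0)}) = (Σ_w S ν 0 κ w) · (Σ_y τ_{(κ,y)}(λ_{(μ,0)}))`
    rw [Finset.sum_comm, Finset.mul_sum]
    refine Finset.sum_congr rfl fun y _ => ?_
    rw [← Finset.sum_mul]
    congr 1
    rw [← sum_sub_left_eq (fun w => S ν 0 κ w) y]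
    exact Finset.sum_congr rfl fun z _ => hS ν z κ y
  · -- the `λ_{a′}`-translated half: `Σ_z Σ_y S μ 0 κ y · τ_{(κ,y)}(λ_{(ν,z)}) = (Σ_y S μ 0 κ y) · (Σ_w τ_{(κ,w)}(λ_{(ν,0)}))`
    rw [Finset.sum_comm, Finset.sum_mul]
    refine Finset.sum_congr rfl fun y _ => ?_
    rw [← Finset.mul_sum]
    congr 1
    rw [← sum_sub_left_eq (fun w => tau κ w (lam ν 0)) y]
    exact Finset.sum_congr rfl fun z _ => hτ κ y ν z

/-! ## §2 No door word on the summed column ⇒ the zeroth moment vanishes -/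

/-- [folklore] **`zerothMoment_symPairing_eq_zero` — an4's `hD0` SHAPE FROM ONE DISPLAYED LETTER**: if the translation-summed gauge column of every direction has no
door word (`hΛ : ∀ κ μ, τ_{(κ,0)}(Σ_z λ_{(μ,z)}) = 0`), the zeroth moment of the covariant symmetrised pairing vanishes for EVERY source pair of directions `(μ, ν)`,
whatever the read-out weights sum to. -/
theorem zerothMoment_symPairing_eq_zero (S : D → G → D → G → ℝ) (tau : D → G → V →ₗ[ℝ] ℝ) (lam : D → G → V)
    (hS : ∀ (ν : D) (z : G) (κ : D) (y : G), S ν z κ y = S ν 0 κ (y - z))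
    (hτ : ∀ (κ : D) (y : G) (μ : D) (z : G), tau κ y (lam μ z) = tau κ (y - z) (lam μ 0))
    (hΛ : ∀ (κ μ : D), tau κ 0 (∑ z, lam μ z) = 0) (μ ν : D) :
    ∑ z, ∑ κ, ∑ y, (S ν z κ y * tau κ y (lam μ 0) + S μ 0 κ y * tau κ y (lam ν z)) = 0 := by
  rw [zerothMoment_symPairing_eq S tau lam hS hτ μ ν]
  simp only [hΛ, mul_zero, add_zero, Finset.sum_const_zero]

/-- [folklore] **`zerothMoment_symPairing_eq_zero_of_translationSum_eq_smul` — THE CONSTANT-COLUMN CASE**: if every translation-summed gauge column is a multiple of ONE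
vector `u` (the constant gauge function) and every base door word kills `u` (§3 for the matrix words), the zeroth moment vanishes. -/
theorem zerothMoment_symPairing_eq_zero_of_translationSum_eq_smul (S : D → G → D → G → ℝ) (tau : D → G → V →ₗ[ℝ] ℝ) (lam : D → G → V)
    (hS : ∀ (ν : D) (z : G) (κ : D) (y : G), S ν z κ y = S ν 0 κ (y - z))
    (hτ : ∀ (κ : D) (y : G) (μ : D) (z : G), tau κ y (lam μ z) = tau κ (y - z) (lam μ 0))
    (u : V) (hu : ∀ κ : D, tau κ 0 u = 0) (hconst : ∀ μ : D, ∃ c : ℝ, ∑ z, lam μ z = c • u) (μ ν : D) :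
    ∑ z, ∑ κ, ∑ y, (S ν z κ y * tau κ y (lam μ 0) + S μ 0 κ y * tau κ y (lam ν z)) = 0 := by
  refine zerothMoment_symPairing_eq_zero S tau lam hS hτ (fun κ μ' => ?_) μ ν
  obtain ⟨c, hc⟩ := hconst μ'
  rw [hc, map_smul, hu, smul_zero]

end Pairing

/-! ## §3 The constant generator has no door (junction to PART 37∕38∕39's matrix words) -/

section ConstantGenerator

variable {ι τ : Type*} [Fintype ι] [DecidableEq ι] [Fintype τ] [DecidableEq τ]

/-- [folklore] **`mul_diagonal_const_comm`**: a scalar generator intertwines every (rectangular) leg: `L̂·diagonal(c) = diagonal(c)·L̂`. -/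
theorem mul_diagonal_const_comm (L : Matrix τ ι ℝ) (c : ℝ) :
    L * Matrix.diagonal (fun _ : ι => c) = Matrix.diagonal (fun _ : τ => c) * L := by
  ext b x
  simp only [Matrix.mul_diagonal, Matrix.diagonal_mul, mul_comm]

omit [Fintype τ] [DecidableEq τ] in
/-- [folklore] **`fineDoor_const_eq_zero`**: the fine door of a constant gauge function is closed: `[diagonal c, B] = 0`. -/
theorem fineDoor_const_eq_zero (B : Matrix ι ι ℝ) (c : ℝ) :
    Matrix.diagonal (fun _ : ι => c) * B - B * Matrix.diagonal (fun _ : ι => c) = 0 := by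
  rw [← mul_diagonal_const_comm B c, sub_self]

omit [Fintype ι] [DecidableEq ι] in
/-- [folklore] **`brickDoor_const_eq_zero`**: the transported brick door of a constant root gauge is closed: `L̂ᵀ·[diagonal c, H]·L̂ = 0`. -/
theorem brickDoor_const_eq_zero (L : Matrix τ ι ℝ) (H : Matrix τ τ ℝ) (c : ℝ) :
    Lᵀ * (Matrix.diagonal (fun _ : τ => c) * H - H * Matrix.diagonal (fun _ : τ => c)) * L = 0 := by
  rw [fineDoor_const_eq_zero H c, Matrix.mul_zero, Matrix.zero_mul]

/-- [folklore] **`doorGap_const_eq_zero`** — PART 38 §4 AT THE SCALAR GENERATOR: with `E = diagonal c` on the fine index and `E′ = diagonal c` on the bricks the legs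
intertwine (`mul_diagonal_const_comm`), so the door gap `[E, L̂ᵀHL̂] − L̂ᵀ[E′,H]L̂` vanishes for every brick table. -/
theorem doorGap_const_eq_zero (L : Matrix τ ι ℝ) (H : Matrix τ τ ℝ) (c : ℝ) :
    (Matrix.diagonal (fun _ : ι => c) * (Lᵀ * H * L) - (Lᵀ * H * L) * Matrix.diagonal (fun _ : ι => c))
      - Lᵀ * (Matrix.diagonal (fun _ : τ => c) * H - H * Matrix.diagonal (fun _ : τ => c)) * L = 0 :=
  doorGap_eq_zero_of_intertwine (fun _ => c) (fun _ => c) L H (mul_diagonal_const_comm L c)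

omit [Fintype τ] [DecidableEq τ] in
/-- [folklore] traced: the fine-door TADPOLE of a constant gauge function vanishes against every table `A`. -/
theorem trace_mul_fineDoor_const (A B : Matrix ι ι ℝ) (c : ℝ) :
    Matrix.trace (A * (Matrix.diagonal (fun _ : ι => c) * B - B * Matrix.diagonal (fun _ : ι => c))) = 0 := by
  rw [fineDoor_const_eq_zero, Matrix.mul_zero, Matrix.trace_zero]

omit [DecidableEq ι] in
/-- [folklore] traced: the transported-brick-door TADPOLE of a constant root gauge vanishes against every table `A`. -/
theorem trace_mul_brickDoor_const (A : Matrix ι ι ℝ) (L : Matrix τ ι ℝ) (H : Matrix τ τ ℝ) (c : ℝ) :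
    Matrix.trace (A * (Lᵀ * (Matrix.diagonal (fun _ : τ => c) * H - H * Matrix.diagonal (fun _ : τ => c)) * L)) = 0 := by
  rw [brickDoor_const_eq_zero, Matrix.mul_zero, Matrix.trace_zero]

/-- [folklore] traced: the door-gap TADPOLE (PART 39's `tr(A·gap)`) of a constant gauge function vanishes against every table `A` — the `K`-twisted transport is zero
because the intertwining defect `K = L̂·(c•1) − (c•1)·L̂` is. -/
theorem trace_mul_doorGap_const (A : Matrix ι ι ℝ) (L : Matrix τ ι ℝ) (H : Matrix τ τ ℝ) (c : ℝ) :
    Matrix.trace (A * ((Matrix.diagonal (fun _ : ι => c) * (Lᵀ * H * L) - (Lᵀ * H * L) * Matrix.diagonal (fun _ : ι => c))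
      - Lᵀ * (Matrix.diagonal (fun _ : τ => c) * H - H * Matrix.diagonal (fun _ : τ => c)) * L)) = 0 := by
  rw [doorGap_const_eq_zero, Matrix.mul_zero, Matrix.trace_zero]

end ConstantGenerator

end Summit.QuantumFields.BalabanUV.Beta.FP.TowerK2bDoorTadpoleZerothMoment

end
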